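import Summits.KontsevichZagierPeriods.KontsevichZagierPeriods.Theses.RootDecompZetaThreeFrontier
import Literature.NumberTheory.Transcendental.MultipleZetaValuesHoffmanProofs
import Literature.NumberTheory.Transcendental.MultipleZetaRepeatedTwosProofs
import Literature.NumberTheory.Transcendental.MultipleZetaDepthTwoProofs
import Literature.NumberTheory.Transcendental.MultipleZetaHoffmanRelationProofs
import Literature.NumberTheory.Transcendental.MZVSimplexRepProofs
import HarnessLib
import Summits.KontsevichZagierPeriods.KontsevichZagierPeriods.Theorems.RootDecompZetaThreeFrontierSupportCollapse
import Summits.KontsevichZagierPeriods.KontsevichZagierPeriods.Theorems.RootDecompZetaThreeFrontierWordMoves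

/-!
# Route RootDecompZetaThreeFrontier — the KERNEL EDGE `GZNormalFormWThree → GenusZeroThreeNormalForm` (item 28709 ⟸ its rank-9 support) — part 1/3 (`…WordCanon`): canonical word representations and the route vocabulary

Theorems-split (3 files, sequential imports `…WordCanon → …WordPackaging → …WordEdge`) of the dependency cone of
`genusZeroThreeNormalForm_of_born` in the decomp-kz lens-1 gen-9 file `run/shared/lean/pub/decomp-kz/decomp-kz-lens-1/g9/WordLayer.lean`
(4838 lines; lens farm rc 0 / 0 err / 0 warn / 0 sorry WITH audit, standard axioms; the audit classifies the edge `proof-of-item (closed)`).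
Part 1: evaluation bookkeeping in `KZ.FormalRep` (`eval_eq_value_of_sub_mem`, `of_sub_of_mem_relations`), the generator sets `wordGensLE k`
(rational multiples of binary MZV-letter words `∏ ωε` on the open ordered simplex `Δ_w`, `w ≤ k`) and the graded statement `GZNormalFormW k`,
the canonical admissible-word representations `canonA` with `k0 A` (the constant `A` on `Δ₀`), `k2 Q` (`Q·ω₀ω₁ = Q ζ(2)`), `k3 q` (`q·ω₀ω₀ω₁ = q ζ(3)`),
their values / domains / integrands, the route-vocabulary statements `WordClosureNFThree`, `PackagingTwo`, `GZNormalFormWThree'` (the latter is the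
born support `Theses.RootDecompZetaThreeFrontier.GZNormalFormWThree` verbatim) and the assembly `genusZeroThreeNormalForm_of_graded :
GZNormalFormW 3 → WordClosureNFThree → PackagingTwo → GenusZeroThreeNormalForm`.  [Kontsevich–Zagier 2001 §1.2; Ihara–Kaneko–Zagier 2006 §1;
Hoffman 1992 Thm 5.1]  Standard axioms, 0 sorry.
-/

noncomputable section

set_option linter.dupNamespace false

open Set MeasureTheory MvPolynomial
open Literature.NumberTheory.Transcendental
open Literature.ModelTheory.ExponentialFields (IsSemialgebraic)
open Summit.KontsevichZagierPeriods.KontsevichZagierPeriods.Theses.RootDecompZetaThreeFrontier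
open Summit.KontsevichZagierPeriods.KontsevichZagierPeriods.Theorems.RootDecompZetaThreeFrontierSupportCollapse
open Summit.KontsevichZagierPeriods.KontsevichZagierPeriods.Theorems.RootDecompZetaThreeFrontierWordMoves

namespace Summit.KontsevichZagierPeriods.KontsevichZagierPeriods.Theorems.RootDecompZetaThreeFrontierWordEdge

variable {w N : ℕ}

/-- The word integrand `q · ∏ᵢ ω_{εᵢ}(tᵢ)`, literally as inlined in items 3912 / 3914 / 15044
(= the disprover's `Negative.wordFun`). -/
def wordFun (ε : Fin w → Bool) (q : ℚ) (t : Fin w → ℝ) : ℝ :=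
  (q : ℝ) * ∏ i, if ε i then 1 / (1 - t i) else 1 / t i

/-- Kontsevich's integrand of an index is the word integrand of its binary word (coefficient `1`). -/
theorem mzvIntegrand_eq_wordFun (u : List ℕ) (t : Fin (MZV.weight u) → ℝ) :
    KZ.mzvIntegrand u t = wordFun (fun i => (MZV.binaryWord u).getD i false) 1 t := by
  simp only [wordFun, Rat.cast_one, one_mul]
  rfl

/-- Soundness on a difference: `of s − m ∈ relations ⇒ eval m = s.value`. -/
theorem eval_eq_value_of_sub_mem {n : ℕ} (s : KZ.IntegralRep n) (m : KZ.FormalRep)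
    (h : KZ.of s - m ∈ KZ.relations) : KZ.eval m = s.value := by
  have h0 : KZ.eval (KZ.of s - m) = 0 := KZ.relations_le_ker_eval_holds h
  rw [map_sub, KZ.eval_of, sub_eq_zero] at h0
  exact h0.symm

/-- A representation whose integrand vanishes on its domain is a relation (rule 1b: `f = f + f`). -/
private theorem of_mem_relations_of_integrand_zero {n : ℕ} (z : KZ.IntegralRep n)
    (hz : ∀ x ∈ z.domain, z.integrand x = 0) : KZ.of z ∈ KZ.relations := by
  have h3 : KZ.of z - KZ.of z - KZ.of z ∈ KZ.relations :=
    KZ.integrandAddRel_subset_relations ⟨n, z, z, z, rfl, rfl, fun x hx => by simp [hz x hx], rfl⟩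
  rw [show KZ.of z - KZ.of z - KZ.of z = -KZ.of z by abel] at h3
  exact neg_mem_iff.mp h3

/-- Congruence: same domain, integrands equal on it ⇒ the two representations differ by a relation
(rule 1b with a zero representation). -/
private theorem of_sub_of_mem_relations {n : ℕ} (r r' : KZ.IntegralRep n) (hd : r'.domain = r.domain)
    (h : EqOn r.integrand r'.integrand r.domain) : KZ.of r - KZ.of r' ∈ KZ.relations := by
  let z : KZ.IntegralRep n := r.constMul 0 isAlgebraic_zero
  have hz : ∀ x ∈ z.domain, z.integrand x = 0 := fun x _ => by
    simp [z, KZ.IntegralRep.integrand_constMul]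
  have h1 : KZ.of r - KZ.of r' - KZ.of z ∈ KZ.relations :=
    KZ.integrandAddRel_subset_relations
      ⟨n, r, r', z, hd, rfl, fun x hx => by simp [z, KZ.IntegralRep.integrand_constMul, h hx], rfl⟩
  have h2 := of_mem_relations_of_integrand_zero z hz
  rw [show KZ.of r - KZ.of r' = (KZ.of r - KZ.of r' - KZ.of z) + KZ.of z by abel]
  exact add_mem h1 h2

/-- Word generators of weight `≤ N` (all weights `w ≤ N` together). -/
def wordGensLE (N : ℕ) : Set KZ.FormalRep :=
  {x | ∃ (w : ℕ) (ε : Fin w → Bool) (q : ℚ) (s : KZ.IntegralRep w), w ≤ N ∧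
    s.domain = {t | (∀ i, 0 < t i) ∧ (∀ i, t i < 1) ∧ StrictAnti t} ∧
    EqOn s.integrand (fun t => (q : ℝ) * ∏ i, if ε i then 1 / (1 - t i) else 1 / t i) s.domain ∧
    x = KZ.of s}

/-- **Weight-sharpened graded normal form**: every genus-zero representation of dimension `k ≤ K` is
congruent to a `ℤ`-combination of word representations of weight `≤ k` (§6's `wordGensLE k`). -/
def GZNormalFormW (K : ℕ) : Prop :=
  ∀ (k : ℕ), k ≤ K → ∀ (r : KZ.IntegralRep k) (p : MvPolynomial (Fin k) ℚ)
    (a : Fin k → Fin k → ℕ) (b c : Fin k → ℕ),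
    r.domain = {t | (∀ i, 0 < t i) ∧ (∀ i, t i < 1) ∧ StrictAnti t} →
    Set.EqOn r.integrand (fun t => MvPolynomial.aeval t p / ((∏ i, t i ^ b i) *
      (∏ i, (1 - t i) ^ c i) * ∏ i, ∏ j, if i < j then (t i - t j) ^ a i j else 1)) r.domain →
    ∃ m ∈ AddSubgroup.closure (wordGensLE k), KZ.of r - m ∈ KZ.relations

/-- Kontsevich's simplex representation of an admissible index with a rational coefficient inside the
integrand, `[Δ_w, q·ω_u]` (`Literature`: `KZ.mzvRep`, `KZ.IntegralRep.constMul`; for a Hoffman index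
this is §3's `canon`). -/
def canonA (u : List ℕ) (hu : MZV.IsAdmissible u) (q : ℚ) : KZ.IntegralRep (MZV.weight u) :=
  KZ.IntegralRep.constMul ((q : ℚ) : ℝ) (isAlgebraic_algebraMap (q : ℚ))
    (KZ.mzvRep u hu (KZ.mzvIntegrand_isSemialgebraicFunOn_holds u)
      (KZ.mzvIntegrand_integrableOn_holds u hu))

/-- (decomp-kz lens-1, `WordLayer.lean` g9) `canonA_integrand`. -/
theorem canonA_integrand (u : List ℕ) (hu : MZV.IsAdmissible u) (q : ℚ) (t : Fin (MZV.weight u) → ℝ) :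
    (canonA u hu q).integrand t = (q : ℝ) * KZ.mzvIntegrand u t := rfl

/-- (decomp-kz lens-1, `WordLayer.lean` g9) `canonA_domain`. -/
theorem canonA_domain (u : List ℕ) (hu : MZV.IsAdmissible u) (q : ℚ) :
    (canonA u hu q).domain = {t | (∀ i, 0 < t i) ∧ (∀ i, t i < 1) ∧ StrictAnti t} := rfl

/-- Kontsevich's formula: `[Δ_w, q·ω_u]` has value `q·ζ(u)`. -/
theorem canonA_value (u : List ℕ) (hu : MZV.IsAdmissible u) (q : ℚ) :
    (canonA u hu q).value = (q : ℝ) * multipleZeta u := by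
  rw [canonA, KZ.IntegralRep.value_constMul, KZ.mzvRep_value_holds]

/-- The integrand of `[Δ_w, q·ω_u]` as a word form, for any letter function `ε` agreeing with `u`. -/
theorem canonA_integrand_word (u : List ℕ) (hu : MZV.IsAdmissible u) (ε : Fin (MZV.weight u) → Bool)
    (hε : ∀ i : Fin (MZV.weight u), (MZV.binaryWord u).getD i false = ε i) (q : ℚ) (t : Fin (MZV.weight u) → ℝ) :
    (canonA u hu q).integrand t = (q : ℝ) * ∏ i, if ε i then 1 / (1 - t i) else 1 / t i := by
  simp only [canonA_integrand, mzvIntegrand_eq_wordFun, wordFun, Rat.cast_one, one_mul, hε]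

/-- **Any representation on `Δ_w` with integrand `q·ω_u` there is congruent to `[Δ_w, q·ω_u]` and has
value `q·ζ(u)`** (congruence `of_sub_of_mem_relations` + soundness; no measure theory). -/
theorem congr_canonA (u : List ℕ) (hu : MZV.IsAdmissible u) (ε : Fin (MZV.weight u) → Bool)
    (hε : ∀ i : Fin (MZV.weight u), (MZV.binaryWord u).getD i false = ε i) (q : ℚ) (s : KZ.IntegralRep (MZV.weight u))
    (hd : s.domain = {t | (∀ i, 0 < t i) ∧ (∀ i, t i < 1) ∧ StrictAnti t})
    (hi : EqOn s.integrand (fun t => (q : ℝ) * ∏ i, if ε i then 1 / (1 - t i) else 1 / t i) s.domain) :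
    KZ.of s - KZ.of (canonA u hu q) ∈ KZ.relations ∧ s.value = (q : ℝ) * multipleZeta u := by
  have hc : KZ.of s - KZ.of (canonA u hu q) ∈ KZ.relations :=
    of_sub_of_mem_relations s (canonA u hu q) (by rw [canonA_domain, hd]) fun t ht => by
      rw [hi ht]
      simp only [canonA_integrand, mzvIntegrand_eq_wordFun, wordFun, Rat.cast_one, one_mul, hε]
  refine ⟨hc, ?_⟩
  have h := eval_eq_value_of_sub_mem s _ hc
  rw [KZ.eval_of, canonA_value] at h
  exact h.symm

/-- (decomp-kz lens-1, `WordLayer.lean` g9) `adm_nil`. -/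
theorem adm_nil : MZV.IsAdmissible [] := by decide

/-- (decomp-kz lens-1, `WordLayer.lean` g9) `binaryWord_three`. -/
theorem binaryWord_three : ∀ i : Fin 3, (MZV.binaryWord [3]).getD i false = ![false, false, true] i := by
  decide

/-- `[pt, A]` (dimension 0). -/
def k0 (A : ℚ) : KZ.IntegralRep 0 := canonA [] adm_nil A

/-- `[Δ₂, Q·ω₀ω₁]` (Kontsevich's `ζ(2)`). -/
def k2 (Q : ℚ) : KZ.IntegralRep 2 := canonA [2] MZV.isAdmissible_two Q

/-- `[Δ₃, q·ω₀ω₀ω₁]` (Kontsevich's `ζ(3)`) — the `z` of 28709. -/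
def k3 (q : ℚ) : KZ.IntegralRep 3 := canonA [3] MZV.isAdmissible_three q

/-- (decomp-kz lens-1, `WordLayer.lean` g9) `k0_value`. -/
theorem k0_value (A : ℚ) : (k0 A).value = A := by
  have h := canonA_value [] adm_nil A
  rw [multipleZeta_nil, mul_one] at h
  exact h

/-- (decomp-kz lens-1, `WordLayer.lean` g9) `k2_value`. -/
theorem k2_value (Q : ℚ) : (k2 Q).value = (Q : ℝ) * (Real.pi ^ 2 / 6) := by
  have h := canonA_value [2] MZV.isAdmissible_two Q
  rw [multipleZeta_two] at h
  exact h

/-- (decomp-kz lens-1, `WordLayer.lean` g9) `k3_domain`. -/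
theorem k3_domain (q : ℚ) : (k3 q).domain = {t | (∀ i, 0 < t i) ∧ (∀ i, t i < 1) ∧ StrictAnti t} := rfl

/-- the integrand of `[Δ₃, q·ω₀ω₀ω₁]` in the form item 28709 spells it -/
theorem k3_integrand (q : ℚ) : EqOn (k3 q).integrand (fun t => (q : ℝ) / (t 0 * t 1 * (1 - t 2)))
    (k3 q).domain := by
  intro t _
  refine (canonA_integrand_word [3] MZV.isAdmissible_three _ binaryWord_three q t).trans ?_
  show (q : ℝ) * ∏ i : Fin 3, (if (![false, false, true] : Fin 3 → Bool) i then 1 / (1 - t i) else 1 / t i) =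
    (q : ℝ) / (t 0 * t 1 * (1 - t 2))
  simp only [Fin.prod_univ_three, div_eq_mul_inv, mul_inv]
  rw [if_neg (by decide : ¬ (![false, false, true] : Fin 3 → Bool) 0 = true),
    if_neg (by decide : ¬ (![false, false, true] : Fin 3 → Bool) 1 = true),
    if_pos (by decide : (![false, false, true] : Fin 3 → Bool) 2 = true)]
  try ring

/-- **Word-closure normal form in weight `≤ 3`** [ATTACKABLE-NOW, move-level]: every `ℤ`-combination of
word representations of weight `≤ 3` is congruent to `[pt, A] + [Δ₂, Q·ω₀₁] + [Δ₃, q·ω₀₀₁]`.  Recipe: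
closure induction; a generator `[Δ_w, q·ω_ε]` is `≡ 0` for non-admissible `ε` (divergence, tree
`Negative.Divergence`), `≡ [Δ₃, q·ω₀₀₁]` for `ε = ω₀₁₁` (duality, tree `Negative.Duality`), and canonical
otherwise (`congr_canonA`); coefficients add by rule 1b (`nsmul_of_canonA_sub_mem`). -/
def WordClosureNFThree : Prop :=
  ∀ m ∈ AddSubgroup.closure (wordGensLE 3), ∃ A Q q : ℚ,
    m - (KZ.of (k0 A) + KZ.of (k2 Q) + KZ.of (k3 q)) ∈ KZ.relations

/-- **Packaging in dimension 2** [ATTACKABLE-NOW, three moves]: `[pt, A] + [Δ₂, Q·ω₀₁]` is congruent to ONE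
rational representation of dimension 2 (e.g. `[(0,1)², A + Q/(1 − xy)]`: product dissection of `Δ₂`,
the substitution `t₁ = xy`, and rule 1b with the constant). -/
def PackagingTwo : Prop :=
  ∀ A Q : ℚ, ∃ ℓ : KZ.IntegralRep 2, ℓ.IsRational ∧ KZ.of ℓ - (KZ.of (k0 A) + KZ.of (k2 Q)) ∈ KZ.relations

/-- **Item 28709 from the graded pieces**: `GZNormalFormW 3 → WordClosureNFThree → PackagingTwo →
GenusZeroThreeNormalForm` — the rank-2 item of the route of record is the dimension-3 rung of the
grading plus two move-level supports; its transcendence content is NIL. -/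
theorem genusZeroThreeNormalForm_of_graded (hN : GZNormalFormW 3) (hW : WordClosureNFThree)
    (hP : PackagingTwo) : GenusZeroThreeNormalForm := by
  intro g p a b c hd hi
  obtain ⟨m, hm, hgm⟩ := hN 3 le_rfl g p a b c hd hi
  obtain ⟨A, Q, q, hmn⟩ := hW m hm
  obtain ⟨ℓ, hℓ, hℓm⟩ := hP A Q
  have hℓv : ℓ.value = (A : ℝ) + Q * (Real.pi ^ 2 / 6) := by
    have h := eval_eq_value_of_sub_mem ℓ _ hℓm
    rw [map_add, KZ.eval_of, KZ.eval_of, k0_value, k2_value] at h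
    exact h.symm
  refine ⟨A, Q, q, ℓ, k3 q, hℓ, hℓv, k3_domain q, k3_integrand q, ?_⟩
  have e : KZ.of g - KZ.of ℓ - KZ.of (k3 q) = (KZ.of g - m) +
      (m - (KZ.of (k0 A) + KZ.of (k2 Q) + KZ.of (k3 q))) - (KZ.of ℓ - (KZ.of (k0 A) + KZ.of (k2 Q))) := by
    abel
  rw [e]
  exact sub_mem (add_mem hgm hmn) hℓm

/-- **`GZNormalFormW 3` in route vocabulary** [support of 28709 · rank 9 · tag «theorem-in-print analogue /
formalisation target (F. Brown, Ann. Sci. ÉNS 42 (2009), periods of `𝔐_{0,6}`)», NOT «⟸ S»]: every genus-zero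
representation of dimension `k ≤ 3` is congruent, modulo the relations of the KZ calculus, to a
`ℤ`-combination of word representations `[Δ_w, q·ω_ε]` of weight `w ≤ k`. -/
def GZNormalFormWThree' : Prop :=
  ∀ (k : ℕ), k ≤ 3 → ∀ (r : KZ.IntegralRep k) (p : MvPolynomial (Fin k) ℚ) (a : Fin k → Fin k → ℕ)
    (b c : Fin k → ℕ), r.domain = {t | (∀ i, 0 < t i) ∧ (∀ i, t i < 1) ∧ StrictAnti t} →
    Set.EqOn r.integrand (fun t => MvPolynomial.aeval t p / ((∏ i, t i ^ b i) * (∏ i, (1 - t i) ^ c i) *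
      ∏ i, ∏ j, if i < j then (t i - t j) ^ a i j else 1)) r.domain →
    ∃ m ∈ AddSubgroup.closure {x : KZ.FormalRep | ∃ (w : ℕ) (ε : Fin w → Bool) (q : ℚ) (s : KZ.IntegralRep w),
        w ≤ k ∧ s.domain = {t | (∀ i, 0 < t i) ∧ (∀ i, t i < 1) ∧ StrictAnti t} ∧
        Set.EqOn s.integrand (fun t => (q : ℝ) * ∏ i, if ε i then 1 / (1 - t i) else 1 / t i) s.domain ∧
        x = KZ.of s},
      KZ.of r - m ∈ KZ.relations

/-- `GZNormalFormWThree'` IS `GZNormalFormW 3`, definitionally. -/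
theorem gzNormalFormWThree'_iff : GZNormalFormWThree' ↔ GZNormalFormW 3 := Iff.rfl

/-- (decomp-kz lens-1, `WordLayer.lean` g9) `binaryWord_two`. -/
theorem binaryWord_two : ∀ i : Fin 2, (MZV.binaryWord [2]).getD i false = ![false, true] i := by
  decide

/-- (decomp-kz lens-1, `WordLayer.lean` g9) `k0_domain`. -/
theorem k0_domain (A : ℚ) : (k0 A).domain = {t | (∀ i, 0 < t i) ∧ (∀ i, t i < 1) ∧ StrictAnti t} := rfl

/-- the integrand of `[pt, A]` is the constant `A` -/
theorem k0_integrand (A : ℚ) (t : Fin 0 → ℝ) : (k0 A).integrand t = A := by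
  have h : (k0 A).integrand t = (A : ℝ) * ∏ i : Fin 0,
      (if (fun i : Fin 0 => (MZV.binaryWord []).getD i false) i then 1 / (1 - t i) else 1 / t i) :=
    canonA_integrand_word [] adm_nil _ (fun _ => rfl) A t
  rw [h]
  simp

/-- the integrand of `[Δ₂, Q·ω₀ω₁]` in the form the route spells it (valid at every point) -/
theorem k2_integrand (Q : ℚ) (t : Fin 2 → ℝ) : (k2 Q).integrand t = (Q : ℝ) / (t 0 * (1 - t 1)) := by
  refine (canonA_integrand_word [2] MZV.isAdmissible_two _ binaryWord_two Q t).trans ?_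
  show (Q : ℝ) * ∏ i : Fin 2, (if (![false, true] : Fin 2 → Bool) i then 1 / (1 - t i) else 1 / t i) =
    (Q : ℝ) / (t 0 * (1 - t 1))
  simp only [Fin.prod_univ_two, div_eq_mul_inv, mul_inv]
  rw [if_neg (by decide : ¬ (![false, true] : Fin 2 → Bool) 0 = true),
    if_pos (by decide : (![false, true] : Fin 2 → Bool) 1 = true)]
  ring

/-- the integrand of `[Δ₃, q·ω₀ω₀ω₁]` in the form the route spells it (valid at every point) -/
theorem k3_integrand' (q : ℚ) (t : Fin 3 → ℝ) : (k3 q).integrand t = (q : ℝ) / (t 0 * t 1 * (1 - t 2)) := by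
  refine (canonA_integrand_word [3] MZV.isAdmissible_three _ binaryWord_three q t).trans ?_
  show (q : ℝ) * ∏ i : Fin 3, (if (![false, false, true] : Fin 3 → Bool) i then 1 / (1 - t i) else 1 / t i) =
    (q : ℝ) / (t 0 * t 1 * (1 - t 2))
  simp only [Fin.prod_univ_three, div_eq_mul_inv, mul_inv]
  rw [if_neg (by decide : ¬ (![false, false, true] : Fin 3 → Bool) 0 = true),
    if_neg (by decide : ¬ (![false, false, true] : Fin 3 → Bool) 1 = true),
    if_pos (by decide : (![false, false, true] : Fin 3 → Bool) 2 = true)]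
  ring

/-- congruence to `[pt, A]` -/
theorem sub_k0_mem (A : ℚ) (z₀ : KZ.IntegralRep 0)
    (hd : z₀.domain = {t | (∀ i, 0 < t i) ∧ (∀ i, t i < 1) ∧ StrictAnti t})
    (hi : EqOn z₀.integrand (fun _ => (A : ℝ)) z₀.domain) : KZ.of z₀ - KZ.of (k0 A) ∈ KZ.relations :=
  of_sub_of_mem_relations z₀ (k0 A) (by rw [k0_domain, hd]) fun t ht => by rw [hi ht, k0_integrand]

/-- congruence to `[Δ₃, q·ω₀ω₀ω₁]` -/
theorem sub_k3_mem (q : ℚ) (z₃ : KZ.IntegralRep 3)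
    (hd : z₃.domain = {t | (∀ i, 0 < t i) ∧ (∀ i, t i < 1) ∧ StrictAnti t})
    (hi : EqOn z₃.integrand (fun t => (q : ℝ) / (t 0 * t 1 * (1 - t 2))) z₃.domain) :
    KZ.of z₃ - KZ.of (k3 q) ∈ KZ.relations :=
  of_sub_of_mem_relations z₃ (k3 q) (by rw [k3_domain, hd]) fun t ht => by rw [hi ht, k3_integrand']

/-- (decomp-kz lens-1, `WordLayer.lean` g9) `mem_simplex_zero`. -/
theorem mem_simplex_zero (t : Fin 0 → ℝ) : t ∈ KZ.openOrderedSimplex 0 :=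
  ⟨fun i => i.elim0, fun i => i.elim0, fun i => i.elim0⟩

/-- (decomp-kz lens-1, `WordLayer.lean` g9) `strictAnti_fin_one`. -/
private theorem strictAnti_fin_one (y : Fin 1 → ℝ) : StrictAnti y := fun a b hab =>
  absurd hab (by rw [Subsingleton.elim a b]; exact lt_irrefl _)

/-- (decomp-kz lens-1, `WordLayer.lean` g9) `openOrderedSimplex_subset_box`. -/
theorem openOrderedSimplex_subset_box (k : ℕ) :
    KZ.openOrderedSimplex k ⊆ Set.pi Set.univ (fun _ => Ioo (0 : ℝ) 1) :=
  fun _ ht i _ => ⟨ht.1 i, ht.2.1 i⟩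

/-- (decomp-kz lens-1, `WordLayer.lean` g9) `volume_openOrderedSimplex_ne_top`. -/
theorem volume_openOrderedSimplex_ne_top (k : ℕ) : volume (KZ.openOrderedSimplex k) ≠ ⊤ := by
  refine ne_top_of_le_ne_top ?_ (measure_mono (openOrderedSimplex_subset_box k))
  rw [Real.volume_pi_Ioo]
  simp

end Summit.KontsevichZagierPeriods.KontsevichZagierPeriods.Theorems.RootDecompZetaThreeFrontierWordEdge
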